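import Summits.QuantumFields.BalabanUV.T4Continuum.Support.VariationalTaxiCoarse
import Summits.QuantumFields.BalabanUV.T4Continuum.Support.VariationalCovariantOneStep

/-!
# T⁴ programme, spine node NE2 (U1a), lane P2 — SUPPORT: TAXI CONTOUR TRANSPORTS vs THE STRAIGHT COARSE TRANSPORT (U(1)), PART 2 —
# the FACE binder `hcross` of leaf ONE⁺ and the MISMATCH binder `hmis` of leaf FED⁺ DISCHARGED; ONE⁺ and FED⁺ for taxi data

NE2 formalisation swarm `b2b-balaban-t4-ne2-formalise-*`, leaf 04 GEN 2 (`prover-b2b-balaban-t4-ne2-formalise-leaf-04-g2-0`); journal INTENT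
CLAIMS.log l.9212.  Part 1 `VariationalTaxiCoarse` has the mechanism (rectangle Stokes `piT_mul_piT_shift`, the corners of the next block,
the two sweeps `lower_sweep` ∕ `upper_sweep`, `norm_lowerHol_sub_one_le`); `VariationalTaxiTransport` has the taxi transports `taxiT R`, the
in-block binder `inBlock_defect_taxiT_le ≤ w := (d−1)(L−1)·a` and UB⁺ for taxi data.  THIS FILE, with `Rc := coarseT R` (the straight coarse
transport of `L` fine bonds from the block base point; [Balaban1985BackgroundPropagators] (3.19) p.393 SHAPE only, abelian):
 * `cross_defect_taxiT_le`: `j_μ + 1 = L → ‖R(x,μ)·conj (taxiT R (x+e_μ))·taxiT R x − coarseT R y μ‖ ≤ (L+1)·w` — the binder `hcross` of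
   `VariationalCovariantOneStep.exists_oneStep_lattice` (leaf-01-g2);
 * `norm_mis_taxiT_le`: `‖mis (coarseT R) R (taxiT R) y μ j‖ ≤ L·w` for EVERY offset — the binder `hmis` of
   `VariationalCovariantFederbush.sum_dirU_Qc_le` (P2 owner);
 * ENDS `exists_oneStep_taxi` (ONE⁺) and `sum_dirU_Qc_taxi` (FED⁺) whose ONLY binders are `|R| = 1`, `‖plaq R − 1‖ ≤ a` (and `0 ≤ a`).
Together with `VariationalTaxiTransport.exists_ub_taxi` (UB⁺): the three transport data of the P2 background tier (in-block `hw`∕`hin`, face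
`hcross`, mismatch `hmis`) are ONE number, the plaquette defect, for taxi transports — k-UNIFORM after the physical prefactors
(`a ≍ α(nL)⁻²` ⇒ `n·L·(L+1)·w ≍ d·α·L/n`, summable down the tower).

HONEST FRAMING (T4-DAG p. 1).  A model-level DICTIONARY between hypothesis sets of OUR leaves; [folklore] abelian lattice gauge bookkeeping;
nothing printed is a hypothesis; no `def`; no `sorry`; axioms standard.  NOT the non-abelian `U(Γ)`∕`Ū` (ordered products); NOT REG⁺ (the
Hessian `hess` of the coarse field for `coarseT R` is untouched DATA of ONE⁺); NOT NE2⁺; NE2 NOT proved; spine 0/9; rung (B)+1 finite T⁴ —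
NOT infinite volume, NOT mass gap, NOT Clay.  HONEST DEPENDENCY (cell, verbatim): continuum YM on T⁴ ⇐ BetaPertH ∧ nine spine estimates
(0/9 proved); BetaPertH ⇐ (D1) ∧ (D4) ∧ CAP+tail; G-an2-4 gates asym, D1 and NE2/3/4.
-/

noncomputable section

open scoped BigOperators ComplexConjugate
open Finset

namespace Summit.QuantumFields.BalabanUV.T4Continuum.VariationalTaxiCoarseBinders

open Literature.MathematicalPhysics.QuantumFieldTheory.Balaban1983to89.B5Prop11Plancherel (Tor fine unitVec)
open Literature.MathematicalPhysics.QuantumFieldTheory.Balaban1983to89.B5Prop11Lower (nsq)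
open Literature.MathematicalPhysics.QuantumFieldTheory.Balaban1983to89.B5Block118 (tstep bpt)
open Summit.QuantumFields.BalabanUV.T4Continuum.ScalarBlockTrialFunction (bpt_add_unitVec_of_eq)
open Summit.QuantumFields.BalabanUV.T4Continuum.VariationalCovariantFederbush (piT Qc dirU mis sum_dirU_Qc_le)
open Summit.QuantumFields.BalabanUV.T4Continuum.VariationalCovariantUpperBound (mul_conj_of_norm_one)
open Summit.QuantumFields.BalabanUV.T4Continuum.VariationalCovariantInterpolant (hess)
open Summit.QuantumFields.BalabanUV.T4Continuum.VariationalCovariantOneStep (exists_oneStep_lattice)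
open Summit.QuantumFields.BalabanUV.T4Continuum.VariationalTaxiTransport
open Summit.QuantumFields.BalabanUV.T4Continuum.VariationalTaxiCoarse

variable {d : ℕ}

/-! ## §4 The face binder of ONE⁺ and the mismatch binder of FED⁺ for taxi transports -/

section Binders

variable (L : ℕ) [NeZero L] (N : Fin d → ℕ) [hN : ∀ μ, NeZero (N μ)]
variable {R : Tor (fine L N) → Fin d → ℂ} (hR1 : ∀ x μ, ‖R x μ‖ = 1)
include hR1

omit hN in
/-- `|hol| = 1`. [folklore] -/
theorem norm_hol (y : Tor N) (j : Fin d → Fin L) (μ : Fin d) : ‖hol L N R y j μ‖ = 1 := by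
  unfold hol
  refine norm_prod_eq_one _ _ fun i _ => ?_
  split_ifs with h
  · exact norm_prod_eq_one _ _ fun _ _ => norm_plaq L N hR1 _ _ _
  · exact norm_one

omit [NeZero L] hN hR1 in
/-- `‖u·v − 1‖ ≤ ‖u − 1‖ + ‖v − 1‖` for `‖u‖ = 1`. [folklore] -/
theorem norm_mul_sub_one_le {u v : ℂ} (hu : ‖u‖ = 1) : ‖u * v - 1‖ ≤ ‖u - 1‖ + ‖v - 1‖ := by
  have e : u * v - 1 = u * (v - 1) + (u - 1) := by ring
  rw [e]
  refine (norm_add_le _ _).trans ?_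
  rw [norm_mul, hu, one_mul, add_comm]

/-- the IN-BLOCK binder of `VariationalTaxiTransport` with the common constant `(d−1)(L−1)(L+1)·a ≥ (d−1)(L−1)·a`, so that ONE⁺ takes
one `m₁` for both bond types. [folklore] -/
theorem inBlock_defect_taxiT_le' {a : ℝ} (ha : ∀ x κ ν, ‖plaq L N R x κ ν - 1‖ ≤ a)
    (y : Tor N) (j : Fin d → Fin L) (μ : Fin d) (h : (j μ : ℕ) + 1 < L) :
    ‖R (bpt L N y j) μ * conj (taxiT L N R (bpt L N y j + unitVec (fine L N) μ)) * taxiT L N R (bpt L N y j) - 1‖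
      ≤ ((d - 1 : ℕ) : ℝ) * ((L - 1 : ℕ) : ℝ) * ((L : ℝ) + 1) * a := by
  have ha0 : 0 ≤ a := (norm_nonneg _).trans (ha (bpt L N y j) μ μ)
  refine (inBlock_defect_taxiT_le L N hR1 ha y j μ h).trans ?_
  have h0 : 0 ≤ ((d - 1 : ℕ) : ℝ) * ((L - 1 : ℕ) : ℝ) * a := by positivity
  have hL : (0 : ℝ) ≤ L := Nat.cast_nonneg _
  nlinarith

/-- **THE FACE BINDER OF ONE⁺ FOR TAXI TRANSPORTS**: on a bond leaving block `y` through its far `μ`-face,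
`‖R(x,μ)·conj (taxiT R (x+e_μ))·taxiT R x − coarseT R y μ‖ ≤ (d−1)(L−1)(L+1)·a`. [folklore] -/
theorem cross_defect_taxiT_le {a : ℝ} (ha : ∀ x κ ν, ‖plaq L N R x κ ν - 1‖ ≤ a)
    (y : Tor N) (j : Fin d → Fin L) (μ : Fin d) (h : (j μ : ℕ) + 1 = L) :
    ‖R (bpt L N y j) μ * conj (taxiT L N R (bpt L N y j + unitVec (fine L N) μ)) * taxiT L N R (bpt L N y j) - coarseT L N R y μ‖
      ≤ ((d - 1 : ℕ) : ℝ) * ((L - 1 : ℕ) : ℝ) * ((L : ℝ) + 1) * a := by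
  have hμd : (μ : ℕ) < d := μ.is_lt
  rw [bpt_add_unitVec_of_eq L N y j μ h, taxiT_bpt, taxiT_bpt]
  -- the pieces
  set A : ℂ := ∏ i ∈ Finset.range (μ : ℕ), leg L N R y j i with hA
  set B : ℂ := leg L N R y j μ with hB
  set C : ℂ := ∏ i ∈ Finset.Ico ((μ : ℕ) + 1) d, leg L N R y j i with hC
  set A' : ℂ := ∏ i ∈ Finset.range (μ : ℕ),
    (if h : i < d then piT L N R (corner L N y j i + tstep (fine L N) μ L) ⟨i, h⟩ (j ⟨i, h⟩ : ℕ) else 1) with hA'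
  set C' : ℂ := ∏ i ∈ Finset.Ico ((μ : ℕ) + 1) d,
    (if h : i < d then piT L N R (corner L N y j i + unitVec (fine L N) μ) ⟨i, h⟩ (j ⟨i, h⟩ : ℕ) else 1) with hC'
  set HL : ℂ := ∏ i ∈ Finset.range (μ : ℕ),
    (if h : i < d then rect L N R (corner L N y j i) μ L ⟨i, h⟩ (j ⟨i, h⟩ : ℕ) else 1) with hHL
  set P : ℂ := coarseT L N R y μ with hP
  set Pμ : ℂ := piT L N R (corner L N y j μ) μ L with hPμ
  set r : ℂ := R (bpt L N y j) μ with hr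
  set r₁ : ℂ := R (corner L N y j ((μ : ℕ) + 1)) μ with hr₁
  -- the two taxi paths in pieces
  have htaxi : taxi L N R y j = A * B * C := prod_range_split (fun i => leg L N R y j i) μ
  have htaxi' : taxi L N R (y + unitVec N μ) (Function.update j μ 0) = A' * 1 * C' := by
    rw [taxi, prod_range_split _ μ, leg_face_eq]
    congr 1
    · congr 1
      refine Finset.prod_congr rfl fun i hi => ?_
      have hiμ : i < (μ : ℕ) := Finset.mem_range.mp hi
      rw [dif_pos (hiμ.trans hμd), leg_face_lt L N y j μ hiμ]
    · refine Finset.prod_congr rfl fun i hi => ?_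
      have hi' := Finset.mem_Ico.mp hi
      rw [dif_pos hi'.2, leg_face_gt L N y j μ h (Nat.lt_of_succ_le hi'.1) hi'.2]
  -- the sweeps
  have hup : r₁ * C' = hol L N R y j μ * (C * r) := by
    have := upper_sweep L N hR1 y j μ d (Nat.succ_le_of_lt hμd) le_rfl
    rw [corner_d] at this
    exact this
  have hlow : P * A' = HL * (A * Pμ) := by
    have := lower_sweep L N hR1 y j μ (μ : ℕ) hμd.le
    exact this
  have hBr : B * r₁ = Pμ := by
    have hL : piT L N R (corner L N y j μ) μ L = piT L N R (corner L N y j μ) μ ((j μ : ℕ) + 1) := by rw [h]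
    rw [hPμ, hL, hB, hr₁, corner_succ L N y j hμd]
    simp only [leg, dif_pos hμd, Fin.eta, piT]
  -- unit moduli
  have nhol := (mul_conj_of_norm_one (norm_hol L N hR1 y j μ)).2
  have nHL' : ‖HL‖ = 1 := by
    refine norm_prod_eq_one _ _ fun i _ => ?_
    split_ifs with h
    · exact norm_rect L N hR1 _ _ _ _ _
    · exact norm_one
  have nHL := (mul_conj_of_norm_one nHL').2
  have nA' : A' * conj A' = 1 := by
    refine (mul_conj_of_norm_one (norm_prod_eq_one _ _ fun i _ => ?_)).1
    split_ifs with h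
    · exact norm_piT L N hR1 _ _ _
    · exact norm_one
  have nC' : C' * conj C' = 1 := by
    refine (mul_conj_of_norm_one (norm_prod_eq_one _ _ fun i _ => ?_)).1
    split_ifs with h
    · exact norm_piT L N hR1 _ _ _
    · exact norm_one
  -- algebra
  have h1 : C * r = conj (hol L N R y j μ) * (r₁ * C') := by
    linear_combination (-(conj (hol L N R y j μ))) * hup + (-(C * r)) * nhol
  have h2 : A * Pμ = conj HL * (P * A') := by
    linear_combination (-(conj HL)) * hlow + (-(A * Pμ)) * nHL
  have key : r * conj (A' * 1 * C') * (A * B * C) = conj (hol L N R y j μ * HL) * P := by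
    calc r * conj (A' * 1 * C') * (A * B * C)
        = conj A' * conj C' * (A * B) * (C * r) := by simp only [map_mul, map_one]; ring
      _ = conj A' * conj C' * (A * B) * (conj (hol L N R y j μ) * (r₁ * C')) := by rw [h1]
      _ = conj (hol L N R y j μ) * conj A' * (C' * conj C') * (A * (B * r₁)) := by ring
      _ = conj (hol L N R y j μ) * conj A' * 1 * (A * Pμ) := by rw [nC', hBr]
      _ = conj (hol L N R y j μ) * conj A' * (conj HL * (P * A')) := by rw [h2]; ring
      _ = conj (hol L N R y j μ) * conj HL * P * (A' * conj A') := by ring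
      _ = conj (hol L N R y j μ * HL) * P := by rw [nA', map_mul]; ring
  rw [htaxi', htaxi, key]
  have e : conj (hol L N R y j μ * HL) * P - P = conj (hol L N R y j μ * HL - 1) * P := by
    simp only [map_mul, map_sub, map_one]; ring
  rw [e, norm_mul, Complex.norm_conj, hP, norm_coarseT L N hR1, mul_one]
  refine (norm_mul_sub_one_le (norm_hol L N hR1 y j μ)).trans ?_
  have hh := norm_hol_sub_one_le L N hR1 y j μ ha
  have hl := norm_lowerHol_sub_one_le L N hR1 y j μ ha hμd.le
  have : ((d - 1 : ℕ) : ℝ) * ((L - 1 : ℕ) : ℝ) * a + ((d - 1 : ℕ) : ℝ) * ((L : ℝ) * ((L - 1 : ℕ) : ℝ) * a)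
      = ((d - 1 : ℕ) : ℝ) * ((L - 1 : ℕ) : ℝ) * ((L : ℝ) + 1) * a := by ring
  linarith

/-- **THE MISMATCH BINDER OF FED⁺ FOR TAXI TRANSPORTS**: for every block, direction and offset,
`‖mis (coarseT R) R (taxiT R) y μ j‖ ≤ (d−1)·L·(L−1)·a`. [folklore] -/
theorem norm_mis_taxiT_le {a : ℝ} (ha : ∀ x κ ν, ‖plaq L N R x κ ν - 1‖ ≤ a) (y : Tor N) (μ : Fin d) (j : Fin d → Fin L) :
    ‖mis L N (coarseT L N R) R (taxiT L N R) y μ j‖ ≤ ((d - 1 : ℕ) : ℝ) * ((L : ℝ) * ((L - 1 : ℕ) : ℝ) * a) := by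
  set HL : ℂ := ∏ i ∈ Finset.range d,
    (if h : i < d then rect L N R (corner L N y j i) μ L ⟨i, h⟩ (j ⟨i, h⟩ : ℕ) else 1) with hHL
  have htaxi' : taxi L N R (y + unitVec N μ) j
      = ∏ i ∈ Finset.range d, (if h : i < d then piT L N R (corner L N y j i + tstep (fine L N) μ L) ⟨i, h⟩ (j ⟨i, h⟩ : ℕ) else 1) := by
    unfold taxi
    refine Finset.prod_congr rfl fun i hi => ?_
    rw [dif_pos (Finset.mem_range.mp hi), leg_next L N y j μ (Finset.mem_range.mp hi)]
  have hsw : coarseT L N R y μ * taxi L N R (y + unitVec N μ) j = HL * (taxi L N R y j * piT L N R (bpt L N y j) μ L) := by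
    have := lower_sweep L N hR1 y j μ d le_rfl
    rw [corner_d, ← htaxi'] at this
    exact this
  have e : mis L N (coarseT L N R) R (taxiT L N R) y μ j = (HL - 1) * (taxi L N R y j * piT L N R (bpt L N y j) μ L) := by
    unfold mis
    rw [taxiT_bpt, taxiT_bpt, hsw]
    ring
  rw [e, norm_mul, norm_mul, norm_taxi L N hR1, norm_piT L N hR1, mul_one, mul_one]
  exact norm_lowerHol_sub_one_le L N hR1 y j μ ha le_rfl

end Binders

/-! ## §5 ENDS: ONE⁺ and FED⁺ for taxi data — binders `|R| = 1` and the plaquette defect only -/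

section Ends

variable (L : ℕ) [NeZero L] (N : Fin d → ℕ) [hN : ∀ μ, NeZero (N μ)]
variable {R : Tor (fine L N) → Fin d → ℂ} (hR1 : ∀ x μ, ‖R x μ‖ = 1)
include hR1

/-- **ONE⁺ WITH TAXI TRANSPORTS** (`VariationalCovariantOneStep.exists_oneStep_lattice` at `T′ := taxiT R`, `Rc := coarseT R`,
`m := (d−1)(L−1)(L+1)·a`): for every coarse `λ` a fine competitor with `Q_T f′ = λ` EXACTLY and
`Σ_μ dirU R f′ μ ≤ (√(L^d/L²·X + (d/4+1/2)·L^d/L·HESS) + √d·m·√(2(1+d²)·L^d·Σ|λ|²))²`, `X`, `HESS` the covariant sums of `λ` for the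
STRAIGHT COARSE TRANSPORT; binders: `|R| = 1`, `‖plaq R − 1‖ ≤ a`, `0 ≤ a`. [folklore] -/
theorem exists_oneStep_taxi {a : ℝ} (ha0 : 0 ≤ a) (ha : ∀ x κ ν, ‖plaq L N R x κ ν - 1‖ ≤ a) (lam : Tor N → ℂ) :
    ∃ f' : Tor (fine L N) → ℂ, (fun y => Qc L N (taxiT L N R) f' y) = lam ∧
      ∑ μ, dirU (fine L N) R f' μ
        ≤ (Real.sqrt ((L : ℝ) ^ d / (L : ℝ) ^ 2 * (∑ μ, dirU N (coarseT L N R) lam μ)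
              + ((d : ℝ) / 4 + 1 / 2) * ((L : ℝ) ^ d / L) * hess N (coarseT L N R) lam)
            + Real.sqrt d * ((((d - 1 : ℕ) : ℝ) * ((L - 1 : ℕ) : ℝ) * ((L : ℝ) + 1) * a)
              * Real.sqrt (2 * (1 + (d : ℝ) ^ 2) * ((L : ℝ) ^ d * nsq lam)))) ^ 2 := by
  have hm0 : 0 ≤ ((d - 1 : ℕ) : ℝ) * ((L - 1 : ℕ) : ℝ) * ((L : ℝ) + 1) * a := by positivity
  exact exists_oneStep_lattice L N (norm_taxiT L N hR1) (norm_coarseT L N hR1) hm0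
    (fun y j μ h => inBlock_defect_taxiT_le' L N hR1 ha y j μ h) (fun y j μ h => cross_defect_taxiT_le L N hR1 ha y j μ h)

/-- **FED⁺ WITH TAXI TRANSPORTS** (`VariationalCovariantFederbush.sum_dirU_Qc_le` at `T′ := taxiT R`, `Rc := coarseT R`,
`m := (d−1)·L·(L−1)·a`): `Σ_μ dirU (coarseT R) (Q_T f′) μ ≤ (√(L²·Σ_μ dirU R f′ μ/L^d) + √d·m·√(Σ|f′|²/L^d))²` for EVERY fine field;
binders: `|R| = 1`, `‖plaq R − 1‖ ≤ a`. [folklore] -/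
theorem sum_dirU_Qc_taxi {a : ℝ} (ha0 : 0 ≤ a) (ha : ∀ x κ ν, ‖plaq L N R x κ ν - 1‖ ≤ a) (f' : Tor (fine L N) → ℂ) :
    ∑ μ, dirU N (coarseT L N R) (Qc L N (taxiT L N R) f') μ
      ≤ (Real.sqrt ((L : ℝ) ^ 2 * (∑ μ, dirU (fine L N) R f' μ) / (L : ℝ) ^ d)
          + Real.sqrt d * ((((d - 1 : ℕ) : ℝ) * ((L : ℝ) * ((L - 1 : ℕ) : ℝ) * a))
            * Real.sqrt ((∑ x, ‖f' x‖ ^ 2) / (L : ℝ) ^ d))) ^ 2 :=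
  sum_dirU_Qc_le L N (coarseT L N R) R (taxiT L N R) (fun x μ => (hR1 x μ).le) (fun x => (norm_taxiT L N hR1 x).le)
    (by positivity) (fun y μ j => norm_mis_taxiT_le L N hR1 ha y μ j) f'

end Ends

end Summit.QuantumFields.BalabanUV.T4Continuum.VariationalTaxiCoarseBinders

end
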